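import Summits.Langlands.Langlands.Theses.IrreducibilityBySelfDuality
import Literature.NumberTheory.GaloisRepresentations.HeckeCharacterArchExistence
import Literature.NumberTheory.GaloisRepresentations.HeckeCharacterArchType
import Literature.NumberTheory.NumberFields.ChevalleyUnitCongruence
import Literature.NumberTheory.QuadraticForms.HilbertSymbol
import Literature.NumberTheory.Automorphic.QuaternionAlgebraExistenceInert
import Literature.NumberTheory.QuadraticForms.HilbertReciprocityInputsProofs
import Mathlib.NumberTheory.NumberField.CMField

/-!
# Sketch (crux-ideate, round 1, ideator 2) for crux `HalfIntegralTwistCM` (stmt-Langlands-14036)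

First-lemma signatures of the three idea cards (A `chevalley-exponent-saturation`,
B `hilbert-symbol-sign-kill`, C `tate-seed-transplant`) plus the shared GL(1) dictionary lemmas.
Everything is a STATEMENT check (proofs `sorry`), except `hilbertReciprocity_available`, which
certifies that Hilbert reciprocity is a sorry-free theorem of the tree (card B's lever).
-/

noncomputable section

open scoped NumberField ComplexConjugate
open NumberField NumberField.InfinitePlace Classical
open Literature.NumberTheory.GaloisRepresentations Literature.NumberTheory.Automorphic
open Literature.NumberTheory.QuadraticForms Literature.NumberTheory.NumberFields

namespace Summit.Langlands.Langlands.Cruxes.HalfIntegralTwistCM.SketchIdeator2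

/-! ## Card B certificate: Hilbert reciprocity (O'Meara 71:18) is PROVED in the tree -/

/-- Hilbert's reciprocity law for every number field, sorry-free: 71:18 from 71:17
(`hilbertReciprocity_of_inert`) and 71:17 proved (`range_localUnits_not_le_of_inertiaDegIn_eq_two_holds`). -/
theorem hilbertReciprocity_available (F : Type) [Field F] [NumberField F] (a b : F) :
    hilbertReciprocity F a b :=
  hilbertReciprocity_of_inert F (range_localUnits_not_le_of_inertiaDegIn_eq_two_holds F) a b

/-! ## Card A: `chevalley-exponent-saturation` -/

/-- A1 (CM torsion identity ⇒ every ANGULAR unit product has exponent `2·|μ_K|`): over a CM field,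
`(ι_w u / |ι_w u|)² = ι_w(u · ū⁻¹)` is a root of unity (Mathlib `IsCMField.unitsMulComplexConjInv`),
so `∏_w (ι_w u/|ι_w u|)^{m_w}` raised to `2 · torsionOrder K` is `1` for EVERY unit and EVERY `m`. -/
theorem cm_unitArchProduct_angular_pow_eq_one (K : Type) [Field K] [NumberField K]
    (hK : IsCMField K) (m : InfinitePlace K → ℤ) (α : (𝓞 K)ˣ) :
    unitArchProduct K m (fun _ => (0 : ℝ)) α ^ (2 * Units.torsionOrder K) = 1 := by
  sorry

/-- A2 (SATURATION: the finite-exponent criterion is insensitive to integer multiples of the type):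
if the unit product of type `(d·m, d·t)` has finite exponent then so does the one of type `(m, t)`. -/
theorem unitArchProduct_saturation (K : Type) [Field K] [NumberField K]
    (m : InfinitePlace K → ℤ) (t : InfinitePlace K → ℝ) (d : ℕ) (hd : 0 < d)
    (h : ∃ M : ℕ, 0 < M ∧ ∀ α : (𝓞 K)ˣ,
      unitArchProduct K (fun w => (d : ℤ) * m w) (fun w => (d : ℝ) * t w) α ^ M = 1) :
    ∃ M : ℕ, 0 < M ∧ ∀ α : (𝓞 K)ˣ, unitArchProduct K m t α ^ M = 1 := by
  sorry

/-- A3 (THE UNIT SIDE OF THE CRUX IN ONE LEMMA): over a CM field, if the type `(mω, T)` of `ω` has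
finite exponent on units and all `mω w` are even (= hypothesis (ii) of the crux), then for every
integer vector `j` the HALF type `(j - mω/2, -T/2)` — the unitary archimedean type of the twisting
character `χ` of the crux, `2p = 1 - e - k + 2N` — has finite exponent on ALL units:
`P(j - mω/2, -T/2)² = P(j,0)² · P(mω, T)⁻¹` and A1. No `K⁺`, no signs, no parity case analysis. -/
theorem halfType_unitArchProduct_pow_eq_one (K : Type) [Field K] [NumberField K]
    (hK : IsCMField K) (mω : InfinitePlace K → ℤ) (T : InfinitePlace K → ℝ)
    (hω : ∃ M : ℕ, 0 < M ∧ ∀ α : (𝓞 K)ˣ, unitArchProduct K mω T α ^ M = 1)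
    (heven : ∀ w, Even (mω w)) (j : InfinitePlace K → ℤ) :
    ∃ M : ℕ, 0 < M ∧ ∀ α : (𝓞 K)ˣ,
      unitArchProduct K (fun w => j w - mω w / 2) (fun w => - T w / 2) α ^ M = 1 := by
  sorry

/-- A4 (ONE CHEVALLEY CALL): a unit character of finite exponent `M` is trivial on a congruence
subgroup — `Chevalley1951.thm1_units` with `m := M` (the `M`-th powers contain `U_a`). -/
theorem congruence_of_finiteExponent (hC : Chevalley1951.thm1_units)
    (K : Type) [Field K] [NumberField K] (f : (𝓞 K)ˣ →* ℂˣ) (M : ℕ) (hM : 0 < M)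
    (hf : ∀ α : (𝓞 K)ˣ, f α ^ M = 1) :
    ∃ a : ℕ, 0 < a ∧ ∀ u : (𝓞 K)ˣ, (a : 𝓞 K) ∣ (u : 𝓞 K) - 1 → f u = 1 := by
  sorry

/-! ## Card B: `hilbert-symbol-sign-kill` -/

/-- B1 (SIGN KILL BY HILBERT RECIPROCITY): for `θ ≠ 0` in a number field `F` there is a level `N`
such that every unit `u ≡ 1 (mod N)` is negative at an EVEN number of the real places where `θ` is
negative: `∏_v (u, θ)_v = 1` with every finite symbol `= 1` (`u, θ` units at odd `v ∤ θ`: unramified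
symbol; `u ∈ F_v^{×2}` at `v ∣ 2θ` by the local square theorem), complex symbols trivial, and
`(u, θ)_w = -1` at a real `w` iff `u_w < 0 ∧ θ_w < 0`. With `θ` of prescribed signs (weak
approximation) this kills EVERY sign character of units on a congruence subgroup — Chevalley for the
totally positive units, without Chebotarev. -/
theorem signKill_of_hilbertReciprocity (F : Type) [Field F] [NumberField F]
    (hHR : ∀ a b : F, hilbertReciprocity F a b) (θ : F) (hθ : θ ≠ 0) :
    ∃ N : ℕ, 0 < N ∧ ∀ u : (𝓞 F)ˣ, (N : 𝓞 F) ∣ (u : 𝓞 F) - 1 →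
      Even (Finset.univ.filter (fun w : InfinitePlace F =>
        w.IsReal ∧ (w.embedding θ).re < 0 ∧ (w.embedding ((u : 𝓞 F) : F)).re < 0)).card := by
  sorry

/-- B2 (units `≡ 1 (mod 4)` of a CM field are REAL): `u/ū` is a root of unity `≡ 1 (mod 4)`, hence
`1` (`N(ζ - 1)` is a prime power or a unit, never divisible by `4^{[K:ℚ]}`); Mathlib:
`IsCMField.unitsMulComplexConjInv`, `unitsMulComplexConjInv_ker = realUnits`. -/
theorem realUnits_of_four_dvd_sub_one (K : Type) [Field K] [NumberField K] [IsCMField K]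
    (u : (𝓞 K)ˣ) (hu : (4 : 𝓞 K) ∣ (u : 𝓞 K) - 1) : u ∈ IsCMField.realUnits K := by
  sorry

/-- B3 (THE HONEST RESIDUE = Patrikis Cor. 2.1.8 (2) at `n = 2` over a totally real field): a
Maass-type Hecke character of `F` with EVEN... i.e. with archimedean type `(0, 2T)` has a "square root
up to signs and finite order": some Hecke character has type `(S, T)` for some sign vector `S`.
The crux implies this for `F = K⁺` and needs it exactly when `Im(e_ι + e_ῑ)` is not constant in `w`. -/
theorem maassHalf_totallyReal (F : Type) [Field F] [NumberField F] [IsTotallyReal F]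
    (ψ : HeckeCharacter F) (T : InfinitePlace F → ℝ)
    (hψ : ψ.HasUnitaryArchType (fun _ => 0) (fun w => 2 * T w)) :
    ∃ (ψ' : HeckeCharacter F) (S : InfinitePlace F → ℤ), ψ'.HasUnitaryArchType S T := by
  sorry

/-! ## Card C: `tate-seed-transplant` -/

/-- C1 (extension of characters into the divisible group `ℂˣ`; Baer / induction). -/
theorem monoidHom_extend_units_complex {G : Type*} [CommGroup G] (H : Subgroup G) (f : H →* ℂˣ) :
    ∃ g : G →* ℂˣ, ∀ h : H, g h = f h := by
  sorry

/-- C2 (TATE'S PROP. VII.4.1 WITH A QUASI-CHARACTER SEED = Weil 1956 extension lemma): EVERY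
continuous character `χinf` of the infinite ideles that kills the global units of some congruence
level `N` is the infinite component of a Hecke character. Construction: `χ₀(k·h) := χinf(h_∞)` on the
open subgroup `Kˣ·(K_∞ˣ × W_{N,f})`, well defined because `Kˣ ∩ (K_∞ˣ × W_{N,f}) = U_N`, then C1
across the finite ray class quotient (or verbatim the tree's `heckeOfRayClassFun` with seed
`x ↦ χinf(x_∞) · φ((x)^N)`). No unitarity, no CM. -/
theorem tateSeed (K : Type) [Field K] [NumberField K]
    (χinf : (InfiniteAdeleRing K)ˣ →ₜ* ℂˣ) (N : ℕ) (hN : 0 < N)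
    (hunits : ∀ u : (𝓞 K)ˣ, (N : 𝓞 K) ∣ (u : 𝓞 K) - 1 →
      χinf (Units.map (algebraMap K (InfiniteAdeleRing K) : K →* InfiniteAdeleRing K)
        (Units.map (algebraMap (𝓞 K) K : 𝓞 K →* K) u)) = 1) :
    ∃ χ : HeckeCharacter K, ∀ x : (InfiniteAdeleRing K)ˣ, χ (infiniteIdeles K x) = χinf x := by
  sorry

/-! ## Shared GL(1) dictionary lemmas (both directions), over a totally complex field -/

/-- D1 (READ): the archimedean parameter `e` of a `GL(1)` datum `ω` over a totally complex `K`
determines the unitary archimedean type `(mω, T)` and the real modulus exponent `r` of its Hecke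
character: `e ι_w - e ῑ_w = mω w ∈ ℤ`, `e ι_w + e ῑ_w = r + i T w` with `r` PLACE-INDEPENDENT, and the
unit product of type `(mω, T)` has finite exponent (it is `θ_{ω,f}(u)⁻¹` on units). Tree inputs:
`exists_heckeCharacter_glOne`, `archParameter_clauses_glOne`, `heckeCharacter_glOne_det_ofArch_expMem`,
`exists_norm_apply_eq_ideleNorm_rpow`, surjectivity of `exp : ℂ → ℂˣ` per place. -/
theorem glOne_read_archType (K : Type) [Field K] [NumberField K] [IsTotallyComplex K]
    (h1 : isCompact_glFiniteIntegralLevel 1 K) (ω : CuspidalAutomorphicRepData 1 K h1)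
    (e : (K →+* ℂ) → ℂ) (hω : ω.1.HasArchParameter (fun ι => {e ι})) :
    ∃ (mω : InfinitePlace K → ℤ) (T : InfinitePlace K → ℝ) (r : ℝ),
      (∀ w : InfinitePlace K, e w.embedding - e (ComplexEmbedding.conjugate w.embedding) = mω w) ∧
      (∀ w : InfinitePlace K,
        e w.embedding + e (ComplexEmbedding.conjugate w.embedding) = r + T w * Complex.I) ∧
      ∃ M : ℕ, 0 < M ∧ ∀ α : (𝓞 K)ˣ, unitArchProduct K mω T α ^ M = 1 := by
  sorry

/-- D2 (WRITE): a Hecke character of unitary archimedean type `(m, t)` twisted by `‖·‖^s` yields a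
cuspidal `GL(1)` datum with archimedean parameter `ι_w ↦ s + (m w + i t w)/2`,
`ῑ_w ↦ s + (-m w + i t w)/2` (`archUnitaryValue m t z = z^{(m+it)/2} z̄^{(-m+it)/2}`). Tree inputs:
`exists_automorphicRepData_detTwist_glOne` / `exists_cuspidal_glOne_hasSatakeParamAt_valueAtUniformizer`,
`exists_heckeCharacter_ideleNorm_cpow`, `heckeCharacter_glOne_det_ofArch_expMem`,
`hasArchParameter_glOne_of_eq_smul_one`. -/
theorem glOne_write_archParameter (K : Type) [Field K] [NumberField K] [IsTotallyComplex K]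
    (h1 : isCompact_glFiniteIntegralLevel 1 K) (ψ : HeckeCharacter K)
    (m : InfinitePlace K → ℤ) (t : InfinitePlace K → ℝ) (hψ : ψ.HasUnitaryArchType m t) (s : ℂ) :
    ∃ χ : CuspidalAutomorphicRepData 1 K h1,
      χ.1.HasArchParameter (fun ι =>
        {s + ((if ι = (InfinitePlace.mk ι).embedding then (m (InfinitePlace.mk ι) : ℂ)
              else -(m (InfinitePlace.mk ι) : ℂ)) + t (InfinitePlace.mk ι) * Complex.I) / 2}) := by
  sorry

/-! ## The crux from the lemmas (shape of card A's line; composition left to crux-plan) -/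

/-- The crux decl, by name (statement check only). -/
example : Prop := Summit.Langlands.Langlands.Theses.IrreducibilityBySelfDuality.HalfIntegralTwistCM

end Summit.Langlands.Langlands.Cruxes.HalfIntegralTwistCM.SketchIdeator2
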